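import Summits.ValiantsHypothesis.ValiantsHypothesis.Theorems.LacunarySymmetroidMatrixDescartesFiniteSectorRealisableElevenThree
import Summits.ValiantsHypothesis.ValiantsHypothesis.Theorems.LacunarySymmetroidMatrixDescartesFiniteSectorEtaTwoSix
import Summits.ValiantsHypothesis.ValiantsHypothesis.Theorems.LacunarySymmetroidMatrixDescartesFiniteSectorSigmaKThreeAll
import Summits.ValiantsHypothesis.ValiantsHypothesis.Theorems.LacunarySymmetroidMatrixDescartesFiniteSectorStampCeilingKThreeAll

/-!
# `MatrixDescartes` — line «finite»: the `(11,3)` cell is EXACT on both sides in both currencies: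
# `ν(11,3) = 47` and `η(11,3) = 94` (by name)

HONEST FRAMING.  Object-search cell `pub-symmetroid`, seat val-sym-eng-3 g8 (census/instrument engine #3).  HELPER of
the crux item `stmt-ValiantsHypothesis-18050` (`Theses.LacunarySymmetroid.MatrixDescartes`, asymptotic in `K`) with NO
closure claim — register bookkeeping only, in the pattern of `…FiniteSectorEtaTenThree`.  The seat's witness
`fullyRealisable_eleven_017_fortyseven` (`…FiniteSectorRealisableElevenThree`: a symmetric `11 × 11` half-pencil on the
extremal basis `(0,1,7)` — a `10 → 11` EXTENSION of a lifted twin-allowed symmetric tropical design, found by the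
top-down (class-reversed) chain search — with a full-positive-rooted determinant of degree `47`) is read against the
kernel ceilings of the `K = 3` column (closed forms, all `m`):

* stamp currency: `stampLawAt_K_three 11 _ : StampLawAt 11 3 47` (`…FiniteSectorStampCeilingKThreeAll`, Stöhr's ceiling
  `⌊(m²+6m+1)/4⌋`) and, here, `not_stampLawAt_eleven_three_46 : ¬ StampLawAt 11 3 46` — so **`ν(11,3) = 47 = n(11,2)`** exactly;
* sector currency: `hypRootLawAt_K_three_all 11 _ : HypRootLawAt 11 3 94` (`…FiniteSectorSigmaKThreeAll`, Conjecture Σ on the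
  `K = 3` column) and, here, `not_hypRootLawAt_eleven_three_93 : ¬ HypRootLawAt 11 3 93` by the PROVED doubling `u ↦ u²`
  (door-p5's adapter `not_hypRootLawAt_of_fullyRealisable`, T2: an in-sector `(11,3)` pencil on `(0,2,14)` of degree `94`) —
  so **`η(11,3) = 94 = σ(11,3)`** exactly.

With `(2,3)` (dense), F4, F5, `(5,3)`, `(6,3)`, `(7,3)`, `(8,3)`, `(9,3)`, `(10,3)` and this cell the `K = 3` column of the instrument table of
`Cruxes/MatrixDescartes/Lines/finite.md` is exact on both sides, by name, for every `m ≤ 11`.  Nothing here bears on the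
crux or on `VP ≠ VNP`.  [folklore] Descartes / postage-stamp bookkeeping; no citation exists or is needed.
-/

-- `Summit.ValiantsHypothesis.ValiantsHypothesis.…` repeats a component by the D-0017 layout
-- (single-conjunct summit), which the `dupNamespace` linter flags; the name is mandated.
set_option linter.dupNamespace false

namespace Summit.ValiantsHypothesis.ValiantsHypothesis.Theorems.LacunarySymmetroidMatrixDescartes.FiniteSector

/-- **`ν(11,3) = 47` is EXACT: the ceiling `46` fails** (witness `fullyRealisable_eleven_017_fortyseven` on `(0,1,6)`).
[folklore] -/
theorem not_stampLawAt_eleven_three_46 : ¬ StampLawAt 11 3 46 := by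
  intro h
  obtain ⟨S, hS, hfull, hdeg⟩ := fullyRealisable_eleven_017_fortyseven
  have := h _ S hS hfull
  omega

/-- **`ν(11,3) = 47` EXACT on both sides** (`n(11,2) = 47`: ceiling `stampLawAt_K_three` at `m = 11`, floor
`not_stampLawAt_eleven_three_46`). [folklore] -/
theorem nu_eleven_three_exact : StampLawAt 11 3 47 ∧ ¬ StampLawAt 11 3 46 :=
  ⟨stampLawAt_K_three 11 (by norm_num), not_stampLawAt_eleven_three_46⟩

/-- **`η(11,3) ≥ 94`**: `¬ HypRootLawAt 11 3 93` — the doubled `(11,3)` realisation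
(`fullyRealisable_eleven_017_fortyseven`): an in-sector (all roots real and simple) symmetric `(11,3)` pencil on `(0,2,14)`
of degree `94` (adapter `not_hypRootLawAt_of_fullyRealisable`, T2). [folklore] -/
theorem not_hypRootLawAt_eleven_three_93 : ¬ HypRootLawAt 11 3 93 :=
  not_hypRootLawAt_of_fullyRealisable fullyRealisable_eleven_017_fortyseven (by norm_num)

/-- **`η(11,3) = 94` EXACT on both sides** (`σ(11,3) = 94 = 2·n(11,2)`: ceiling `hypRootLawAt_K_three_all` at `m = 11`, floor
`not_hypRootLawAt_eleven_three_93`). [folklore] -/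
theorem eta_eleven_three_exact : HypRootLawAt 11 3 94 ∧ ¬ HypRootLawAt 11 3 93 :=
  ⟨hypRootLawAt_K_three_all 11 (by norm_num), not_hypRootLawAt_eleven_three_93⟩

end Summit.ValiantsHypothesis.ValiantsHypothesis.Theorems.LacunarySymmetroidMatrixDescartes.FiniteSector
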